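import Literature.IUT.HodgeArakelov.EtaleThetaDataOfSetting
import Literature.AnabelianGeometry.EtaleTheta.SettingModelChiTwistedLatticeKummer
import Literature.AnabelianGeometry.EtaleTheta.LDeltaThetaIndex
import HarnessLib

/-!
# [IUTchII] Prop. 1.4 / [EtTh] Cor. 2.18 (i): the named hypothesis (H1) `PiYddCharacteristic C` is a SCHEMA —
# universal-closure certificate at the lattice-twisted χ-model (proof-only)

S. Mochizuki, *Inter-universal Teichmüller theory II*, §1, Prop. 1.4, kurims manuscript (Dec. 2020) p. 27 ("the open subgroup
`Π_Ÿ(Π) ⊆ Π` corresponding to the tempered covering `Ÿ`") [claim: Mochizuki2012, status: disputed] (IUTchII §1 Prop 1.4, kurims p.27);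
[EtTh] Cor. 2.18 (i) p. 57.  abc-iut cell, K-L6 slice, row «KL6-CLOSURE-CERT F-2633» (abc-iut-L6-lead GO-LONG 2026-08-26T21:44:04Z),
seat abc-iut-L6-t19.  PROOF-ONLY companion of abc-iut-L6-t1/L6-d6's `EtaleThetaDataOfSetting.lean` (no `def`, no `instance`, nothing
re-typed), over this seat's lattice-twisted χ-model (`SettingModelChiTwistedLattice*.lean`: `ThetaSetting.modelLat`, `swapPi`,
`etaleThetaDataLat`) — «lattice twist of Ẑ(1)², not the (B) section twist».

WHAT.  F-2633 `PiYddCharacteristic C` ("every topological automorphism of `Π^tp_X̲̲` stabilises `Π^tp_Ÿ̲̲`") is a HYPOTHESIS of the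
L6 certificate (K-L6 census: the last undecided input).  At every GENUINE-shaped inhabitant in the tree it is open (census
HOME/staging/L6/L6-t19/F2633-CLOSURE-CENSUS.md).  Here we inhabit the records at the lattice model with the DEGENERATE choice
`X̲̲ := X` (`l := 1`, `Π^tp_X̲̲ := Π^tp_X`; admissible because `K = K̈ = ℚ_p` there) over the étale theta datum of the class `1`, and
the swap `t₁ ↔ t₂` of the inert lattice `Ẑ(1)²` moves `Π^tp_Ÿ` (`map_swapPi_gtpYdd_ne`): `¬ PiYddCharacteristic C□`, hence
`not_forall_piYddCharacteristic`.  INSTANCE FORMS the cone uses, BY NAME: `piYddCharacteristic_of_cor218_i` (ROUTE A, F-0620 at the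
instance), `…_of_prop24`, `…_of_thm16Inputs`; abc-iut-f-142's MChar reduction at modelTate; abc-iut-L6-d6's COR218I-AT-MODELTATE.

HONEST FRAMING: a refuted universal closure is a statement about OUR typing (the records admit a semi-synthetic setting with an inert
`Ẑ(1)²` on which nothing printed depends) — it decides (H1)/F-2633 at NO genuine instance, says nothing about [EtTh] Cor. 2.18 (i),
and takes no side on [IUTchIII] Cor. 3.12; typed ≠ proved; nothing asserts abc proved or refuted.
-/

noncomputable section

namespace Literature.IUT.HodgeArakelov

open Literature.AnabelianGeometry.EtaleTheta Literature.AnabelianGeometry.EtaleTheta.SettingModel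
open Literature.AnabelianGeometry.EtaleTheta.ThetaSetting

/-- **An inhabitant `(p, D, E, l, C)` of the records at which (H1) FAILS**: `p := 3`, `D := ThetaSetting.modelLat 3`,
`E := kummerDataLat`'s étale theta datum of the class `ContH1.mk 1 _`, `l := 1`, `X̲̲ := X` (`Huu := ⊤`).
[claim: Mochizuki2012, status: disputed] (IUTchII §1 Prop 1.4, kurims p.27) -/
theorem exists_doubleUnderline_not_piYddCharacteristic :
    ∃ (D : Literature.AnabelianGeometry.EtaleTheta.ThetaSetting 3) (E : D.EtaleThetaData) (C : E.DoubleUnderline 1),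
      ¬ EtaleThetaDataOfSetting.PiYddCharacteristic C := by
  haveI : Fact (Nat.Prime 3) := ⟨Nat.prime_three⟩
  let D : Literature.AnabelianGeometry.EtaleTheta.ThetaSetting 3 := ThetaSetting.modelLat 3
  -- the étale theta datum of the TRIVIAL class, represented by the constant cocycle `1`
  let η : D.H1 D.GtpYdd := ContH1.mk (1 : ↥D.GtpYdd → D.DeltaTheta) (Subgroup.one_mem _)
  let E : D.EtaleThetaData := ThetaSetting.KummerData.etaleThetaDataOfClass (kummerDataLat 3) η
  -- `K̈ = K` at the model (`q̈ = p ∈ ℚ_p`)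
  have hKdd : D.Kdd = D.K := D.Kdd_eq_K_of_sqrtqX_mem (natCast_mem ⊥ 3)
  -- the degenerate covering `X̲̲ := X`
  let C : E.DoubleUnderline 1 :=
    { l_odd := odd_one
      Huu := ⊤
      isOpen_Huu := isOpen_univ
      map_aug_Ydduu := by
        rw [inf_top_eq, D.map_aug_GtpYdd_eq_GKdd]
        show D.Kdd.fixingSubgroup = D.K.fixingSubgroup
        rw [hKdd]
      map_toZ_Huu := by
        rw [← MonoidHom.range_eq_map, MonoidHom.range_eq_top.mpr D.toZ_surjective, Nat.cast_one]
        refine (eq_top_iff.mpr fun x _ => Subgroup.mem_zpowers_iff.mpr ⟨Multiplicative.toAdd x, ?_⟩).symm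
        rw [← ofAdd_zsmul, smul_eq_mul, mul_one, ofAdd_toAdd]
      relIndex_Huu_GtpY := by rw [top_inf_eq, Subgroup.relIndex_self]
      map_toTheta_Huu := by
        rw [← MonoidHom.range_eq_map, MonoidHom.range_eq_top.mpr D.toTheta_surjective, top_inf_eq, lDeltaTheta_one]
      eta_res := by
        refine ⟨(ContH1.resCocycle D.toTheta D.DeltaTheta (inf_le_left : D.GtpYdd ⊓ ⊤ ≤ D.GtpYdd)
            ⟨1, Subgroup.one_mem _⟩).1,
          (ContH1.resCocycle D.toTheta D.DeltaTheta inf_le_left ⟨1, Subgroup.one_mem _⟩).2, fun g => ?_, ?_⟩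
        · rw [lDeltaTheta_one]
          exact Subtype.mem _
        · rfl }
  refine ⟨D, E, C, fun hchar => ?_⟩
  -- the swap automorphism, transported to `Π^tp_X̲̲ = ⊤`
  let α : (EtaleThetaDataOfSetting.Pi C) ≃ₜ* (EtaleThetaDataOfSetting.Pi C) :=
    { toFun := fun x => ⟨swapPi 3 x.1, Subgroup.mem_top _⟩
      invFun := fun x => ⟨(swapPi 3).symm x.1, Subgroup.mem_top _⟩
      left_inv := fun x => Subtype.ext ((swapPi 3).symm_apply_apply x.1)
      right_inv := fun x => Subtype.ext ((swapPi 3).apply_symm_apply x.1)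
      map_mul' := fun x y => Subtype.ext (map_mul (swapPi 3) x.1 y.1)
      continuous_toFun := ((swapPi 3).continuous.comp continuous_subtype_val).subtype_mk _
      continuous_invFun := ((swapPi 3).symm.continuous.comp continuous_subtype_val).subtype_mk _ }
  have hα := hchar α
  -- the witness `w = ((1, (1, η 1)), 1) ∈ Π^tp_Ÿ`, moved out by the swap
  let w : PiTpLat 3 := SemidirectProduct.inl ((1 : Gfp), ((1 : ZH), ZHatLevel.eta 1))
  have hw : (⟨w, Subgroup.mem_top w⟩ : EtaleThetaDataOfSetting.Pi C) ∈ EtaleThetaDataOfSetting.PiYdd C := by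
    rw [Subgroup.mem_subgroupOf]
    exact Subgroup.mem_inf.mpr ⟨inl_latt_mem_gtpYdd 3, Subgroup.mem_top _⟩
  have hαw : α ⟨w, Subgroup.mem_top w⟩ ∈ EtaleThetaDataOfSetting.PiYdd C := by
    rw [← hα]
    exact ⟨_, hw, rfl⟩
  rw [Subgroup.mem_subgroupOf] at hαw
  exact swapPi_inl_latt_not_mem_gtpYdd 3 (Subgroup.mem_inf.mp hαw).1

/-- **F-2633 is a schema**: the universal closure of `EtaleThetaDataOfSetting.PiYddCharacteristic` — over all primes `p`, all
[EtTh] §1 settings `D`, all étale theta data `E`, all `l` and all choices `X̲̲` (`C : E.DoubleUnderline l`) — is FALSE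
(`exists_doubleUnderline_not_piYddCharacteristic`).  Instance forms consumed by the cone, BY NAME:
`EtaleThetaDataOfSetting.piYddCharacteristic_of_cor218_i` / `_of_prop24` / `_of_thm16Inputs`.
[claim: Mochizuki2012, status: disputed] (IUTchII §1 Prop 1.4, kurims p.27) -/
theorem not_forall_piYddCharacteristic :
    ¬ ∀ (p : ℕ) [Fact p.Prime] (D : Literature.AnabelianGeometry.EtaleTheta.ThetaSetting p) (E : D.EtaleThetaData) (l : ℕ)
        (C : E.DoubleUnderline l), EtaleThetaDataOfSetting.PiYddCharacteristic C := by
  intro h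
  haveI : Fact (Nat.Prime 3) := ⟨Nat.prime_three⟩
  obtain ⟨D, E, C, hC⟩ := exists_doubleUnderline_not_piYddCharacteristic
  exact hC (h 3 D E 1 C)

end Literature.IUT.HodgeArakelov

end
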